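import Literature.NumberTheory.GaloisRepresentations.WeilDeligneRepMonodromyProofs
import Literature.NumberTheory.GaloisRepresentations.LocalClassFieldTheoryProofs
import Literature.NumberTheory.GaloisRepresentations.LocalGaloisGroupInertiaProofs
import Literature.NumberTheory.GaloisRepresentations.LocalH2VanishingTrivialModule
import Literature.NumberTheory.GaloisRepresentations.LAdicCharacterUnramifiedAEProofs
import Literature.NumberTheory.GaloisRepresentations.ToLocalRestrictField
import Mathlib.RingTheory.RootsOfUnity.AlgebraicallyClosed
import HarnessLib

/-!
# Grothendieck's monodromy theorem on `Γ_K`, and the local conditions of a soluble base change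
# as open conditions (ACC+ 2023, proof of Thm. 6.1.1: the extension `E₀/F`)

Topic `NumberTheory/GaloisRepresentations` (vocabulary of `WeilGroup` / `WeilDeligneRep` /
`LocalGaloisGroup`: `WeilGroup K`, `WeilGroup.inertia`, `WeilGroup.toAbsGalois`, `absInertia K`,
`residueFieldCard K`; of `GaloisRep`: `FramedGaloisRep`, `toLocal`, `restrictField`; of
`AbsGaloisGroup`: `absGaloisRestrict`, `absClosureEmbedding`; of `AdeleBaseChange`:
`adicCompletionOfLiesOver`).  Theorem-only file (no new definition, no named fact).

## What is here

**§1 Grothendieck's `ℓ`-adic monodromy theorem for the absolute Galois group.**  The tree proves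
Grothendieck's quasi-unipotence theorem for continuous representations of the WEIL group
(`FramedRep.exists_isOpen_isNilpotent_sub_one_holds`, `WeilDeligneRepMonodromyProofs`: for
`ρ : W_K →ₜ* GL_n(E)` with `‖q_K‖_E = 1` there is an open subgroup of the inertia group on which
`ρ` is unipotent).  Serre–Tate state it for the Galois group `G = Gal(K̄/K)` itself
([Serre–Tate 1968, Appendix, Proposition and Corollary]: "there exists an open subgroup `H` of the
inertia group such that `ρ(s)` is unipotent for all `s ∈ H`").  We transport it:
`exists_isOpen_forall_absInertia_isNilpotent_sub_one` (an open neighbourhood `V` of `1` in `Γ_K`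
with `ρ(σ) - 1` nilpotent for `σ ∈ I_K ∩ V`; via `W_K → Γ_K` restricted to `I_K` being a
topological embedding onto `absInertia K`, `WeilGroup.isEmbedding_toAbsGalois_restrict_inertia_holds`,
`WeilGroup.inertia_map_toAbsGalois`) and
`exists_openSubgroup_forall_absInertia_isNilpotent_sub_one` (an open SUBGROUP `U ≤ Γ_K` with
`ρ` unipotent on `U ∩ I_K`; Krull topology: `V ⊇ Gal(K̄/K')` for a finite `K'/K`,
Mathlib `krullTopology_mem_nhds_one_iff`).

**§2** Unipotency of `ρ(σ)` is invariant under a change of frame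
(`isNilpotent_units_conj_sub_one_iff`, `FramedRep.isNilpotent_conj_apply_sub_one_iff`).

**§3–§4 The local conditions imposed on the soluble CM extension `E₀/F` in the proof of ACC+
Thm. 6.1.1 are OPEN conditions on `Γ_{F_v}`, hence are met by any finite extension whose local
absolute Galois groups are small enough.**  In the proof of [ACCGHLNSTT2023, Thm. 6.1.1]
(arXiv:1812.09999 p. 88 bottom – p. 89 top) one chooses "a soluble CM extension `E₀/F`" such that,
at every finite prime-to-`p` place `w` of `E₀` where `π_{E₀}` or `ρ|_{G_{E₀}}` ramifies,
"`ρ|_{G_{E_{0,w}}}` is unipotently ramified, `q_w ≡ 1 mod p`, and `ρ̄|_{G_{E_{0,w}}}` is trivial"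
(unipotently ramified = every element of inertia acts unipotently, the lifting condition `𝒟_v^1`
of §6.2.5, p. 68: `char_{ρ(σ)}(X) = (X - 1)^n` for `σ ∈ I_{F_v}`).  The existence of such an
`E₀` is the standard combination of Grothendieck's monodromy theorem with the Grunwald–Wang-type
lemma [ClozelHarrisTaylor2008, Lemma 4.1.2] — vendored in the tree (CM form, 2026-08-17) as the
named fact `NumberFields.ClozelHarrisTaylor2008.exists_solvable_cm_extension_local`, whose local
requirement at `v ∈ S` is exactly CONTAINMENT of `res(Γ_{L_w})` in a prescribed OPEN SUBGROUP
`U_v ≤ Γ_{F_v}` along `absGaloisRestrict F_v L_w` for the algebra `adicCompletionOfLiesOver F L v w`.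
This file supplies the Galois-theoretic input in precisely that currency:

* `exists_openSubgroup_adicCompletion_local_conditions` (§3): for a number field `F`, a finite
  place `v` with `‖q_v‖_E = 1`, a framed `ρ : Γ_F → GL_n(E)` and a homomorphism `τ` on `Γ_F` with
  open kernel (e.g. a residual representation `ρ̄`, `FramedGaloisRep.isOpen_ker_of_isResidualRepOf`),
  and a prime `p`, there are an open subgroup `U ≤ Γ_{F_v}` and a primitive `p`-th root of unity
  `ζ ∈ F̄_v` such that (1) `ρ|_{Γ_{F_v}}(σ) - 1` is nilpotent for `σ ∈ U ∩ I_{F_v}`,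
  (2) `τ(σ|_{F̄}) = 1` for `σ ∈ U`, (3) `U` fixes `ζ`;
  `exists_openSubgroup_adicCompletion_local_conditions_padicAlgCl`: the case `E = ℚ̄_p`, `v ∤ p`.
* §4, for a finite extension `L/F` of number fields, `w ∣ v`, and `res(Γ_{L_w}) ⊆ U`:
  (1) ⇒ `isNilpotent_toLocal_restrictField_sub_one_of_forall_mem`: `(ρ|_{Γ_L})|_{Γ_{L_w}}` is
  unipotent on the inertia group `I_{L_w}` ("`ρ|_{G_{L_w}}` is unipotently ramified"; inputs: the
  change-of-route lemma `exists_toLocal_restrictField_eq_conj` of `ToLocalRestrictField` and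
  `res(I_{L_w}) ≤ I_{F_v}`, `absInertia_map_absGaloisRestrict_le_holds`);
  (2) ⇒ `apply_absGaloisRestrict_absGaloisRestrict_eq_one_of_forall_mem`: `τ` is trivial on the
  image of `Γ_{L_w} → Γ_L → Γ_F` ("`ρ̄|_{G_{L_w}}` is trivial"; the two routes `Γ_{L_w} → Γ_F` are
  conjugate, `exists_absGaloisRestrict_adicCompletion_eq_conj`);
  (3) ⇒ `residueCard_modEq_one_of_forall_smul_eq`: if moreover `w ∤ p` then `q_w ≡ 1 [MOD p]`
  (`ζ ∈ L_w` by Galois descent `L̄_w^{Γ_{L_w}} = L_w`, Mathlib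
  `InfiniteGalois.mem_range_algebraMap_iff_fixed`, and `μ_p(L_w) ≠ 1 ⇒ p ∣ q_w - 1` for `w ∤ p`,
  `adicCompletion_pow_eq_one_imp` of `LocalH2VanishingTrivialModule`);
  assembled in `local_conditions_of_forall_mem`.

Supports the named fact `ACCGHLNSTT2023.automorphyLifting_crystalline_weightZero`
(`Automorphic/ACCAutomorphyLiftingCrystalline`): together with the bricks already in the tree
(`SplitPrimesDisjointnessAbsolute`, `ResidualHypothesesVSplit`, `ToLocalRestrictField`,
`ResidualRepRestrict`, `LocalH2VanishingTrivialModule`, `DecomposedGenericInfinite`, …) this is the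
Galois side of the passage from `F` to `E = E₀ · E_a · E_b · E_c` in the printed proof; the automorphic
side (Iwahori-spherical `π_{E₀,w}`), the `R = T` theorem (Cor. 6.5.5) and soluble base change /
descent (Prop. 6.5.13) are not addressed here.

## References

* [SerreTate1968GoodReduction] J.-P. Serre, J. Tate, *Good reduction of abelian varieties*,
  Ann. of Math. 88 (1968), Appendix (Grothendieck's monodromy theorem for `Gal(K̄/K)`).
* [ACCGHLNSTT2023] P. B. Allen et al., *Potential automorphy over CM fields*, Ann. of Math. 197
  (2023), §6.2.5 (p. 68 of arXiv:1812.09999) and proof of Thm. 6.1.1, §6.5 (pp. 88–89).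
* [ClozelHarrisTaylor2008] L. Clozel, M. Harris, R. Taylor, Publ. Math. IHÉS 108 (2008),
  Lemma 4.1.2 (p. 116).
* [Corvallis1979] J. Tate, *Number theoretic background*, (1.4.1) (topology of `W_K`).
-/

noncomputable section

open scoped MatrixGroups NumberField
open NumberField IsDedekindDomain Field Topology
open Literature.NumberTheory.Automorphic

namespace Literature.NumberTheory.GaloisRepresentations

/-! ### §1 Grothendieck's monodromy theorem for `Γ_K` -/

section Local

variable {K : Type*} [Field K] [ValuativeRel K] [TopologicalSpace K] [IsNonarchimedeanLocalField K]
  {E : Type*} [NontriviallyNormedField E] {n : ℕ}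

open IsNonarchimedeanLocalField

/-- **Grothendieck's `ℓ`-adic monodromy theorem, absolute-Galois-group form (open neighbourhood).**
Let `K` be a non-archimedean local field with residue field of `q` elements, `E` a non-trivially
normed field with `‖q‖_E = 1` (e.g. `E/ℚ_ℓ` algebraic, `ℓ ∤ q`) and `ρ : Γ_K →ₜ* GL_n(E)` continuous.
Then there is an open neighbourhood `V` of `1` in `Γ_K` such that `ρ(σ) - 1` is nilpotent for every
`σ ∈ I_K ∩ V`.  (Grothendieck's theorem for `ρ|_{W_K}`, `FramedRep.exists_isOpen_isNilpotent_sub_one_holds`,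
transported along the topological embedding `I_K ⊆ W_K → Γ_K`.)
[cite: SerreTate1968GoodReduction, Appendix, Proposition and Corollary] -/
theorem exists_isOpen_forall_absInertia_isNilpotent_sub_one
    (hq : ‖(residueFieldCard K : E)‖ = 1) (ρ : FramedRep (absoluteGaloisGroup K) E n) :
    ∃ V : Set (absoluteGaloisGroup K), IsOpen V ∧ 1 ∈ V ∧
      ∀ σ ∈ absInertia K, σ ∈ V →
        IsNilpotent (((ρ σ : GL (Fin n) E) : Matrix (Fin n) (Fin n) E) - 1) := by
  obtain ⟨U, -, hUo, hU⟩ :=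
    FramedRep.exists_isOpen_isNilpotent_sub_one_holds (F := K) (E := E) (n := n) hq
      (ρ.comp (WeilGroup.toAbsGaloisContinuous K))
  have hemb := WeilGroup.isEmbedding_toAbsGalois_restrict_inertia_holds K
  set I : Set (WeilGroup K) := (WeilGroup.inertia K : Set (WeilGroup K)) with hI
  have hUo' : IsOpen ((Subtype.val : ↥I → WeilGroup K) ⁻¹' (U : Set (WeilGroup K))) :=
    hUo.preimage continuous_subtype_val
  obtain ⟨V, hVo, hVU⟩ := hemb.isInducing.isOpen_iff.mp hUo'
  refine ⟨V, hVo, ?_, ?_⟩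
  · have h1 : (⟨1, (WeilGroup.inertia K).one_mem⟩ : ↥I) ∈
        (Subtype.val : ↥I → WeilGroup K) ⁻¹' (U : Set (WeilGroup K)) :=
      U.one_mem
    rw [← hVU] at h1
    simpa using h1
  · intro σ hσI hσV
    have hσ' : σ ∈ (WeilGroup.inertia K).map (WeilGroup.toAbsGalois K) := by
      rw [WeilGroup.inertia_map_toAbsGalois]
      exact hσI
    obtain ⟨u, huI, rfl⟩ := Subgroup.mem_map.mp hσ'
    have hu : (⟨u, huI⟩ : ↥I) ∈ (Subtype.val : ↥I → WeilGroup K) ⁻¹' (U : Set (WeilGroup K)) := by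
      rw [← hVU]
      exact hσV
    simpa using hU u hu

/-- **Grothendieck's `ℓ`-adic monodromy theorem, absolute-Galois-group form (open subgroup).**
Under the hypotheses of `exists_isOpen_forall_absInertia_isNilpotent_sub_one` there is an open
subgroup `U ≤ Γ_K` such that `ρ(σ) - 1` is nilpotent for all `σ ∈ U ∩ I_K`: every `ℓ`-adic
representation of `Γ_K` becomes unipotent on inertia over a finite extension of `K`
(`U ⊇ Gal(K̄/K')`, `K'/K` finite, Mathlib `krullTopology_mem_nhds_one_iff`).
[cite: SerreTate1968GoodReduction, Appendix, Proposition and Corollary] -/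
theorem exists_openSubgroup_forall_absInertia_isNilpotent_sub_one
    (hq : ‖(residueFieldCard K : E)‖ = 1) (ρ : FramedRep (absoluteGaloisGroup K) E n) :
    ∃ U : OpenSubgroup (absoluteGaloisGroup K), ∀ σ ∈ U, σ ∈ absInertia K →
      IsNilpotent (((ρ σ : GL (Fin n) E) : Matrix (Fin n) (Fin n) E) - 1) := by
  obtain ⟨V, hVo, h1, hV⟩ := exists_isOpen_forall_absInertia_isNilpotent_sub_one hq ρ
  obtain ⟨L, hfin, hL⟩ :=
    (krullTopology_mem_nhds_one_iff K (AlgebraicClosure K) V).mp (hVo.mem_nhds h1)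
  haveI := hfin
  exact ⟨⟨L.fixingSubgroup, L.fixingSubgroup_isOpen⟩, fun σ hσ hσI => hV σ hσI (hL hσ)⟩

end Local

/-! ### §2 Unipotency is invariant under a change of frame -/

section Conj

/-- `P A P⁻¹ - 1` is nilpotent iff `A - 1` is (`P` a unit): `P A P⁻¹ - 1 = P (A - 1) P⁻¹`.
[folklore] -/
theorem isNilpotent_units_conj_sub_one_iff {R : Type*} [Ring R] (P : Rˣ) (A : R) :
    IsNilpotent ((P : R) * A * ((P⁻¹ : Rˣ) : R) - 1) ↔ IsNilpotent (A - 1) := by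
  have key : ∀ (Q : Rˣ) (B : R), IsNilpotent (B - 1) →
      IsNilpotent ((Q : R) * B * ((Q⁻¹ : Rˣ) : R) - 1) := by
    rintro Q B ⟨k, hk⟩
    refine ⟨k, ?_⟩
    have e : (Q : R) * B * ((Q⁻¹ : Rˣ) : R) - 1 = (Q : R) * (B - 1) * ((Q⁻¹ : Rˣ) : R) := by
      rw [mul_sub, sub_mul, mul_one, Units.mul_inv]
    rw [e, Units.conj_pow, hk, mul_zero, zero_mul]
  refine ⟨fun h => ?_, key P A⟩
  have h' := key P⁻¹ _ h
  have e : ((P⁻¹ : Rˣ) : R) * ((P : R) * A * ((P⁻¹ : Rˣ) : R)) * (((P⁻¹)⁻¹ : Rˣ) : R) = A := by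
    rw [inv_inv, ← mul_assoc, ← mul_assoc, Units.inv_mul, one_mul, Units.inv_mul_cancel_right]
  rwa [e] at h'

/-- For a framed representation `ρ` and a change of frame `P`, `(P ρ P⁻¹)(g) - 1` is nilpotent iff
`ρ(g) - 1` is. [folklore] -/
theorem FramedRep.isNilpotent_conj_apply_sub_one_iff {G : Type*} [Group G] [TopologicalSpace G]
    {A : Type*} [CommRing A] [TopologicalSpace A] [IsTopologicalRing A] {n : ℕ}
    (P : GL (Fin n) A) (ρ : FramedRep G A n) (g : G) :
    IsNilpotent (((FramedRep.conj P ρ g : GL (Fin n) A) : Matrix (Fin n) (Fin n) A) - 1) ↔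
      IsNilpotent (((ρ g : GL (Fin n) A) : Matrix (Fin n) (Fin n) A) - 1) := by
  rw [FramedRep.conj_apply, Units.val_mul, Units.val_mul]
  exact isNilpotent_units_conj_sub_one_iff P _

end Conj

/-! ### §2b Unipotent = characteristic polynomial `(X - 1)^n` (the lifting condition `𝒟_v^1`) -/

section Charpoly

open Polynomial

/-- Over a field, if `A - 1` is nilpotent then `charpoly A = (X - 1)^n`: `charpoly (A - 1) = X^n`
(Mathlib `Matrix.isNilpotent_charpoly_sub_pow_of_isNilpotent`, `K[X]` is reduced) and
`charpoly A (X) = charpoly (A - 1) (X - 1)` (entrywise `charmatrix A = (charmatrix (A - 1)) ∘ (X - 1)`).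
This is the direction "unipotent on inertia ⇒ lifting of type `𝒟_v^1`"
(`char_{ρ(σ)}(X) = ∏ (X - 1)`, ACC+ §6.2.5); the converse is the tree's
`Monodromy.isNilpotent_sub_one_of_charpoly_eq` (Cayley–Hamilton). [folklore] -/
theorem charpoly_eq_X_sub_one_pow_of_isNilpotent_sub_one {K : Type*} [Field K] {ι : Type*}
    [Fintype ι] [DecidableEq ι] {A : Matrix ι ι K} (h : IsNilpotent (A - 1)) :
    A.charpoly = (X - 1) ^ Fintype.card ι := by
  set N : Matrix ι ι K := A - 1 with hN
  have hA : A = N + 1 := by rw [hN, sub_add_cancel]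
  have hNc : N.charpoly = X ^ Fintype.card ι :=
    sub_eq_zero.mp (Matrix.isNilpotent_charpoly_sub_pow_of_isNilpotent h).eq_zero
  have hcm : (N + 1).charmatrix = N.charmatrix.map (Polynomial.compRingHom (X - C 1)) := by
    refine Matrix.ext fun i j => ?_
    by_cases hij : i = j
    · subst hij
      rw [Matrix.map_apply, Matrix.charmatrix_apply_eq, Matrix.charmatrix_apply_eq,
        Polynomial.coe_compRingHom_apply, Matrix.add_apply, Matrix.one_apply_eq, map_add, map_one,
        sub_comp, X_comp, C_comp]
      ring
    · rw [Matrix.map_apply, Matrix.charmatrix_apply_ne _ _ _ hij, Matrix.charmatrix_apply_ne _ _ _ hij,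
        Polynomial.coe_compRingHom_apply, Matrix.add_apply, Matrix.one_apply_ne hij, add_zero,
        neg_comp, C_comp]
  rw [hA, Matrix.charpoly, hcm, ← RingHom.mapMatrix_apply, ← RingHom.map_det, ← Matrix.charpoly,
    hNc, Polynomial.coe_compRingHom_apply, X_pow_comp, map_one]

/-- Over a field, `A - 1` is nilpotent iff `charpoly A = (X - 1)^n` (`GL_n`: unipotent elements are
those with characteristic polynomial `(X - 1)^n`). [folklore] -/
theorem isNilpotent_sub_one_iff_charpoly_eq {K : Type*} [Field K] {n : ℕ}
    (A : Matrix (Fin n) (Fin n) K) : IsNilpotent (A - 1) ↔ A.charpoly = (X - 1) ^ n :=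
  ⟨fun h => by simpa using charpoly_eq_X_sub_one_pow_of_isNilpotent_sub_one h,
    Monodromy.isNilpotent_sub_one_of_charpoly_eq⟩

end Charpoly

/-! ### §3 At a finite place of a number field: the open subgroup `U ≤ Γ_{F_v}` -/

section NumberField

variable {F : Type} [Field F] [NumberField F] {E : Type*} [NontriviallyNormedField E] {n : ℕ}

/-- **The local conditions at a level-raising place are open conditions.**  Let `F` be a number
field, `v` a finite place whose residue cardinality `q_v` has `‖q_v‖_E = 1`, `ρ : Γ_F → GL_n(E)` a
framed continuous representation, `τ : Γ_F → H` a homomorphism with open kernel (a residual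
representation `ρ̄`), and `p` a prime.  Then there are an open subgroup `U ≤ Γ_{F_v}` and a
primitive `p`-th root of unity `ζ ∈ \overline{F_v}` such that
(1) `ρ|_{Γ_{F_v}}(σ) - 1` is nilpotent for all `σ ∈ U ∩ I_{F_v}` (Grothendieck),
(2) `τ(σ|_{F̄}) = 1` for all `σ ∈ U`, and (3) every `σ ∈ U` fixes `ζ`.
This is the Galois-theoretic input for the choice of the soluble CM extension `E₀/F` in the proof
of ACC+ Thm. 6.1.1 ("`ρ|_{G_{E_{0,w}}}` is unipotently ramified, `q_w ≡ 1 mod p`, and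
`ρ̄|_{G_{E_{0,w}}}` is trivial"), in the currency (open subgroups of `Γ_{F_v}`) of the tree's
`ClozelHarrisTaylor2008.exists_solvable_cm_extension_local`; see §4 for the transfer to `L_w`.
[cite: ACCGHLNSTT2023, §6.5, proof of Thm. 6.1.1 (choice of E₀, pp. 88–89 of arXiv:1812.09999)]
[cite: SerreTate1968GoodReduction, Appendix] -/
theorem exists_openSubgroup_adicCompletion_local_conditions (v : HeightOneSpectrum (𝓞 F))
    (hq : ‖(v.residueCard : E)‖ = 1) (ρ : FramedGaloisRep F E n)
    {H : Type*} [Group H] (τ : absoluteGaloisGroup F →* H)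
    (hτ : IsOpen (τ.ker : Set (absoluteGaloisGroup F))) (p : ℕ) [Fact p.Prime] :
    ∃ (U : OpenSubgroup (absoluteGaloisGroup (v.adicCompletion F)))
      (ζ : AlgebraicClosure (v.adicCompletion F)), IsPrimitiveRoot ζ p ∧
      (∀ σ ∈ U, σ ∈ absInertia (v.adicCompletion F) →
        IsNilpotent (((ρ.toLocal v σ : GL (Fin n) E) : Matrix (Fin n) (Fin n) E) - 1)) ∧
      (∀ σ ∈ U, τ (absGaloisRestrict F (v.adicCompletion F) σ) = 1) ∧
      (∀ σ ∈ U, σ • ζ = ζ) := by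
  -- (1) Grothendieck's monodromy theorem on `Γ_{F_v}`
  have hq' : ‖(IsNonarchimedeanLocalField.residueFieldCard (v.adicCompletion F) : E)‖ = 1 := by
    rw [Automorphic.residueFieldCard_adicCompletion_eq]
    exact hq
  obtain ⟨U₁, hU₁⟩ :=
    exists_openSubgroup_forall_absInertia_isNilpotent_sub_one hq' (ρ.toLocal v)
  -- (2) the open kernel of `τ`, pulled back to `Γ_{F_v}`
  let U₂ : OpenSubgroup (absoluteGaloisGroup (v.adicCompletion F)) :=
    ⟨τ.ker.comap (absGaloisRestrict F (v.adicCompletion F)).toMonoidHom,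
      hτ.preimage (absGaloisRestrict F (v.adicCompletion F)).continuous_toFun⟩
  -- (3) the stabiliser of a primitive `p`-th root of unity
  haveI : CharZero (v.adicCompletion F) :=
    charZero_of_injective_algebraMap (algebraMap F (v.adicCompletion F)).injective
  haveI : NeZero ((p : ℕ) : v.adicCompletion F) :=
    ⟨Nat.cast_ne_zero.mpr (Fact.out : p.Prime).ne_zero⟩
  obtain ⟨ζ, hζ⟩ :=
    HasEnoughRootsOfUnity.exists_primitiveRoot (AlgebraicClosure (v.adicCompletion F)) p
  let U₃ : OpenSubgroup (absoluteGaloisGroup (v.adicCompletion F)) :=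
    ⟨MulAction.stabilizer (absoluteGaloisGroup (v.adicCompletion F)) ζ,
      stabilizer_isOpen_of_isIntegral ζ⟩
  refine ⟨U₁ ⊓ U₂ ⊓ U₃, ζ, hζ, ?_, ?_, ?_⟩
  · intro σ hσ hI
    exact hU₁ σ (OpenSubgroup.mem_inf.mp (OpenSubgroup.mem_inf.mp hσ).1).1 hI
  · intro σ hσ
    exact (OpenSubgroup.mem_inf.mp (OpenSubgroup.mem_inf.mp hσ).1).2
  · intro σ hσ
    exact (OpenSubgroup.mem_inf.mp hσ).2

/-- `exists_openSubgroup_adicCompletion_local_conditions` for `ℚ̄_p`-coefficients at a place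
`v ∤ p` (then `‖q_v‖_p = 1`), the setting of ACC+ Thm. 6.1.1 (`ρ : Γ_F → GL_n(ℚ̄_p)`, `τ = ρ̄`
with open kernel, `FramedGaloisRep.isOpen_ker_of_isResidualRepOf`).
[cite: ACCGHLNSTT2023, §6.5, proof of Thm. 6.1.1 (choice of E₀, pp. 88–89 of arXiv:1812.09999)] -/
theorem exists_openSubgroup_adicCompletion_local_conditions_padicAlgCl {p : ℕ} [Fact p.Prime]
    (v : HeightOneSpectrum (𝓞 F)) (hpv : ((p : ℕ) : 𝓞 F) ∉ v.asIdeal) {n : ℕ}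
    (ρ : FramedGaloisRep F (PadicAlgCl p) n)
    {H : Type*} [Group H] (τ : absoluteGaloisGroup F →* H)
    (hτ : IsOpen (τ.ker : Set (absoluteGaloisGroup F))) :
    ∃ (U : OpenSubgroup (absoluteGaloisGroup (v.adicCompletion F)))
      (ζ : AlgebraicClosure (v.adicCompletion F)), IsPrimitiveRoot ζ p ∧
      (∀ σ ∈ U, σ ∈ absInertia (v.adicCompletion F) →
        IsNilpotent (((ρ.toLocal v σ : GL (Fin n) (PadicAlgCl p)) :
          Matrix (Fin n) (Fin n) (PadicAlgCl p)) - 1)) ∧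
      (∀ σ ∈ U, τ (absGaloisRestrict F (v.adicCompletion F) σ) = 1) ∧
      (∀ σ ∈ U, σ • ζ = ζ) :=
  exists_openSubgroup_adicCompletion_local_conditions v
    (PadicAlgCl.norm_natCast_eq_one_of_not_dvd
      (not_dvd_residueCard_of_natCast_not_mem v (Fact.out : p.Prime) hpv)) ρ τ hτ p

/-! ### §4 Transfer to a finite extension `L_w / F_v` with `res(Γ_{L_w}) ⊆ U` -/

variable {L : Type} [Field L] [NumberField L] [Algebra F L]

/-- **(1) ⇒ "`ρ|_{G_{L_w}}` is unipotently ramified".**  Let `L/F` be a finite extension of number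
fields, `w ∣ v`, `U ⊆ Γ_{F_v}` a set on whose inertia elements `ρ|_{Γ_{F_v}}` is unipotent, and
suppose the restriction `Γ_{L_w} → Γ_{F_v}` (along `F_v → L_w`, `adicCompletionOfLiesOver`) takes
values in `U`.  Then `(ρ|_{Γ_L})|_{Γ_{L_w}}(σ') - 1` is nilpotent for every `σ' ∈ I_{L_w}`:
`(ρ|_{Γ_L})|_{Γ_{L_w}}` is a `GL_n`-conjugate of `ρ|_{Γ_{F_v}} ∘ res` (`exists_toLocal_restrictField_eq_conj`)
and `res(I_{L_w}) ≤ I_{F_v}` (`absInertia_map_absGaloisRestrict_le_holds`).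
[cite: ACCGHLNSTT2023, §6.5, proof of Thm. 6.1.1 (conditions on E₀, p. 89 of arXiv:1812.09999)] -/
theorem isNilpotent_toLocal_restrictField_sub_one_of_forall_mem
    {A : Type*} [CommRing A] [TopologicalSpace A] [IsTopologicalRing A] {n : ℕ}
    (ρ : FramedGaloisRep F A n) (v : HeightOneSpectrum (𝓞 F)) (w : HeightOneSpectrum (𝓞 L))
    [w.asIdeal.LiesOver v.asIdeal] {U : Set (absoluteGaloisGroup (v.adicCompletion F))}
    (hU₁ : ∀ σ ∈ U, σ ∈ absInertia (v.adicCompletion F) →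
      IsNilpotent (((ρ.toLocal v σ : GL (Fin n) A) : Matrix (Fin n) (Fin n) A) - 1))
    (hU : letI := (adicCompletionOfLiesOver F L v w).toAlgebra
      ∀ σ' : absoluteGaloisGroup (w.adicCompletion L),
        absGaloisRestrict (v.adicCompletion F) (w.adicCompletion L) σ' ∈ U) :
    ∀ σ' ∈ absInertia (w.adicCompletion L),
      IsNilpotent ((((ρ.restrictField L).toLocal w σ' : GL (Fin n) A) :
        Matrix (Fin n) (Fin n) A) - 1) := by
  letI := (adicCompletionOfLiesOver F L v w).toAlgebra
  obtain ⟨τ₀, hτ₀⟩ := exists_toLocal_restrictField_eq_conj ρ v w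
  have hI := absInertia_map_absGaloisRestrict_le_holds (v.adicCompletion F) (w.adicCompletion L)
  intro σ' hσ'
  rw [hτ₀, FramedRep.isNilpotent_conj_apply_sub_one_iff]
  exact hU₁ _ (hU σ') (hI (Subgroup.mem_map_of_mem _ hσ'))

/-- **(2) ⇒ "`ρ̄|_{G_{L_w}}` is trivial".**  Let `L/F` be a finite extension of number fields,
`w ∣ v`, `τ` a homomorphism on `Γ_F` trivial on the restrictions to `F̄` of the elements of
`U ⊆ Γ_{F_v}`, and suppose `res(Γ_{L_w}) ⊆ U`.  Then `τ` kills the image of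
`Γ_{L_w} → Γ_L → Γ_F`, i.e. the residual representation `τ ∘ res_{L/F}` of `ρ|_{Γ_L}` is trivial on
the decomposition group at `w` (the routes `Γ_{L_w} → Γ_L → Γ_F` and `Γ_{L_w} → Γ_{F_v} → Γ_F`
are conjugate, `exists_absGaloisRestrict_adicCompletion_eq_conj`).
[cite: ACCGHLNSTT2023, §6.5, proof of Thm. 6.1.1 (conditions on E₀, p. 89 of arXiv:1812.09999)] -/
theorem apply_absGaloisRestrict_absGaloisRestrict_eq_one_of_forall_mem
    {H : Type*} [Group H] (τ : absoluteGaloisGroup F →* H)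
    (v : HeightOneSpectrum (𝓞 F)) (w : HeightOneSpectrum (𝓞 L)) [w.asIdeal.LiesOver v.asIdeal]
    {U : Set (absoluteGaloisGroup (v.adicCompletion F))}
    (hU₂ : ∀ σ ∈ U, τ (absGaloisRestrict F (v.adicCompletion F) σ) = 1)
    (hU : letI := (adicCompletionOfLiesOver F L v w).toAlgebra
      ∀ σ' : absoluteGaloisGroup (w.adicCompletion L),
        absGaloisRestrict (v.adicCompletion F) (w.adicCompletion L) σ' ∈ U) :
    ∀ σ' : absoluteGaloisGroup (w.adicCompletion L),
      τ (absGaloisRestrict F L (absGaloisRestrict L (w.adicCompletion L) σ')) = 1 := by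
  letI := (adicCompletionOfLiesOver F L v w).toAlgebra
  obtain ⟨τ₁, hτ₁⟩ := exists_absGaloisRestrict_adicCompletion_eq_conj (F := F) (E := L) v w
  intro σ'
  rw [hτ₁ σ', map_mul, map_mul, hU₂ _ (hU σ'), mul_one, map_inv, mul_inv_cancel]

/-- **(3) ⇒ "`q_w ≡ 1 mod p`".**  Let `L/F` be a finite extension of number fields, `w ∣ v` with
`w ∤ p`, `ζ ∈ \overline{F_v}` a primitive `p`-th root of unity fixed by every element of
`U ⊆ Γ_{F_v}`, and suppose `res(Γ_{L_w}) ⊆ U`.  Then `q_w ≡ 1 [MOD p]`: the image of `ζ` in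
`\overline{L_w}` is fixed by `Γ_{L_w}` (`absGaloisRestrict_apply_smul`), hence lies in `L_w`
(`L̄_w^{Γ_{L_w}} = L_w`), so `L_w` contains a `p`-th root of unity `≠ 1`, which for `w ∤ p` forces
`p ∣ q_w - 1` (`adicCompletion_pow_eq_one_imp`).
[cite: ACCGHLNSTT2023, §6.5, proof of Thm. 6.1.1 (conditions on E₀, p. 89 of arXiv:1812.09999)]
[cite: NeukirchANT1999, II §5 Prop. (5.3) and (5.7)] -/
theorem residueCard_modEq_one_of_forall_smul_eq {p : ℕ} [Fact p.Prime]
    (v : HeightOneSpectrum (𝓞 F)) (w : HeightOneSpectrum (𝓞 L)) [w.asIdeal.LiesOver v.asIdeal]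
    (hpw : ((p : ℕ) : 𝓞 L) ∉ w.asIdeal)
    {ζ : AlgebraicClosure (v.adicCompletion F)} (hζ : IsPrimitiveRoot ζ p)
    {U : Set (absoluteGaloisGroup (v.adicCompletion F))} (hU₃ : ∀ σ ∈ U, σ • ζ = ζ)
    (hU : letI := (adicCompletionOfLiesOver F L v w).toAlgebra
      ∀ σ' : absoluteGaloisGroup (w.adicCompletion L),
        absGaloisRestrict (v.adicCompletion F) (w.adicCompletion L) σ' ∈ U) :
    w.residueCard ≡ 1 [MOD p] := by
  letI := (adicCompletionOfLiesOver F L v w).toAlgebra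
  set ι := absClosureEmbedding (v.adicCompletion F) (w.adicCompletion L) with hι
  have hfix : ∀ g : absoluteGaloisGroup (w.adicCompletion L), g • ι ζ = ι ζ := fun g => by
    rw [hι, ← absGaloisRestrict_apply_smul, hU₃ _ (hU g)]
  haveI : CharZero (w.adicCompletion L) :=
    charZero_of_injective_algebraMap (algebraMap L (w.adicCompletion L)).injective
  haveI : IsGalois (w.adicCompletion L) (AlgebraicClosure (w.adicCompletion L)) := {}
  obtain ⟨z, hz⟩ := (InfiniteGalois.mem_range_algebraMap_iff_fixed (ι ζ)).mpr hfix
  have hzp : z ^ p = 1 := by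
    apply (algebraMap (w.adicCompletion L) (AlgebraicClosure (w.adicCompletion L))).injective
    rw [map_pow, hz, ← map_pow, hζ.pow_eq_one, map_one, map_one]
  have hz1 : z ≠ 1 := by
    intro h
    apply hζ.ne_one (Fact.out : p.Prime).one_lt
    apply ι.toRingHom.injective
    change ι ζ = ι 1
    rw [map_one, ← hz, h, map_one]
  by_contra hq
  exact hz1 (adicCompletion_pow_eq_one_imp w hpw hq z hzp)

/-- **Assembly: the level-raising local conditions hold over any `L` with `res(Γ_{L_w}) ⊆ U`.**
Let `v ∤ p` be a finite place of the number field `F`, `ρ : Γ_F → GL_n(ℚ̄_p)` framed continuous and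
`τ` a homomorphism on `Γ_F` with open kernel.  There is an open subgroup `U ≤ Γ_{F_v}` such that
for every finite extension `L/F` of number fields and every place `w ∣ v` of `L` whose absolute
Galois group restricts into `U` (the local conclusion of
`ClozelHarrisTaylor2008.exists_solvable_cm_extension_local`): `(ρ|_{Γ_L})|_{Γ_{L_w}}` is unipotent
on `I_{L_w}`, `τ ∘ res_{L/F}` is trivial on the image of `Γ_{L_w}`, and `q_w ≡ 1 [MOD p]` — the
three conditions imposed at the ramified prime-to-`p` places of the soluble CM extension `E₀/F` in
the proof of ACC+ Thm. 6.1.1.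
[cite: ACCGHLNSTT2023, §6.5, proof of Thm. 6.1.1 (choice of E₀, pp. 88–89 of arXiv:1812.09999)]
[cite: ClozelHarrisTaylor2008, Lemma 4.1.2 (p. 116)] -/
theorem exists_openSubgroup_forall_local_conditions_of_forall_mem {p : ℕ} [Fact p.Prime]
    (v : HeightOneSpectrum (𝓞 F)) (hpv : ((p : ℕ) : 𝓞 F) ∉ v.asIdeal) {n : ℕ}
    (ρ : FramedGaloisRep F (PadicAlgCl p) n)
    {H : Type*} [Group H] (τ : absoluteGaloisGroup F →* H)
    (hτ : IsOpen (τ.ker : Set (absoluteGaloisGroup F))) :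
    ∃ U : OpenSubgroup (absoluteGaloisGroup (v.adicCompletion F)),
      ∀ (L : Type) [Field L] [NumberField L] [Algebra F L] (w : HeightOneSpectrum (𝓞 L))
        [w.asIdeal.LiesOver v.asIdeal],
        (letI := (adicCompletionOfLiesOver F L v w).toAlgebra
          ∀ σ' : absoluteGaloisGroup (w.adicCompletion L),
            absGaloisRestrict (v.adicCompletion F) (w.adicCompletion L) σ' ∈ U) →
        (∀ σ' ∈ absInertia (w.adicCompletion L),
          IsNilpotent ((((ρ.restrictField L).toLocal w σ' : GL (Fin n) (PadicAlgCl p)) :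
            Matrix (Fin n) (Fin n) (PadicAlgCl p)) - 1)) ∧
        (∀ σ' : absoluteGaloisGroup (w.adicCompletion L),
          τ (absGaloisRestrict F L (absGaloisRestrict L (w.adicCompletion L) σ')) = 1) ∧
        w.residueCard ≡ 1 [MOD p] := by
  obtain ⟨U, ζ, hζ, hU₁, hU₂, hU₃⟩ :=
    exists_openSubgroup_adicCompletion_local_conditions_padicAlgCl v hpv ρ τ hτ
  refine ⟨U, fun L _ _ _ w _ hU => ⟨?_, ?_, ?_⟩⟩
  · exact isNilpotent_toLocal_restrictField_sub_one_of_forall_mem ρ v w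
      (U := (U : Set (absoluteGaloisGroup (v.adicCompletion F)))) hU₁ hU
  · exact apply_absGaloisRestrict_absGaloisRestrict_eq_one_of_forall_mem τ v w
      (U := (U : Set (absoluteGaloisGroup (v.adicCompletion F)))) hU₂ hU
  · have hpw : ((p : ℕ) : 𝓞 L) ∉ w.asIdeal := by
      rwa [natCast_mem_asIdeal_iff_of_liesOver v w]
    exact residueCard_modEq_one_of_forall_smul_eq v w hpw hζ
      (U := (U : Set (absoluteGaloisGroup (v.adicCompletion F)))) hU₃ hU

end NumberField

end Literature.NumberTheory.GaloisRepresentations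

end
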